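import Summits.Parity.GeneralizedHardyLittlewood.Theorems.LeeYangFibresAbsoluteUpgradeDipDefs
import Summits.Parity.GeneralizedHardyLittlewood.Theorems.LeeYangFibresModelHyperbolicityCalculus
import Summits.Parity.GeneralizedHardyLittlewood.Theorems.LeeYangFibresAbsoluteUpgradeAnatomyAlongAux
import Summits.Parity.GeneralizedHardyLittlewood.Theorems.LeeYangFibresModelCellFactsParityPoint
import HarnessLib

/-!
# Route `LeeYangFibres`, crux `AbsoluteUpgrade` (stmt-Parity-14116), line `dip-margin-rate-exchange`:
# the numerics of one scale (helper for the stub `stub_quantClip`)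

Helper file 4/· for the registered stub `stub_quantClip`: the real-number bookkeeping of ONE scale `N` of the
rate clipping lemma, isolated from the quantifier assembly (`quantClip_assembly`).  With `U = U(N)`,
`Lg = log N`, the saving exponent `δ`, the mass threshold `η₀`, and the margin parameters `ϑ = U^{-2t}`,
`r = U^{-2t-4}`, `f = U^{-U}`, `ν₀ = 2^{t-1} U^{t-1}/(η₀ Lg^δ)`:

* `quantClip_numericsB` — from `2^{t+1} U^{U+3t-1}/η₀ ≤ Lg^δ` and `2t + 4 ≤ U`: `4ν₀ ≤ ϑ`, `ν₀ ≤ ϑ f`,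
  `3 e^{-U²}/8 ≤ r`;
* `quantClip_smallness` — `E₀ U^{t-1} Lg ≤ ν₀ · MS · a_1^{t-1}` for `E₀ = N/(Lg^t Lg^δ)`, `η₀ N ≤ MS`, `a_1 ≥ 1/(2 Lg)`;
* `quantClip_errorA` — the law's own error: `E₀ ≤ (ε/2) N/Lg^t` once `2^{t+1} U^{U+3t-1}/η₀ ≤ Lg^δ`, `η₀ ≤ ε`;
* `quantClip_caseA` — small mass `MS < η₀ N`, `η₀ = ε/(4·4^t)`: `|Θ − 1| X ≤ (ε/2) N/Lg^t`;
* `quantClip_caseB` — clipped amplitudes `|Θ − 1| ≤ 2^t 8^{t-1}(2^t+1) U^{-2t}` against the mass growth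
  `MS ≤ C N (log log N)^{t-1}`, `log log N ≤ (2U+2)²`: `|Θ − 1| X ≤ (ε/2) N/Lg^t` once `U ≥ 2K₃/ε`;
* `quantClip_scaleFacts` (registered helper) — the anatomy along the schedule repackaged for the fibre lemmas:
  densities `a_n = A_n/N` against `I_{n-1}(U) = cellDensity (n-1) U` for ALL `1 ≤ n ≤ U` (the top cell and the
  top density both vanish), `εa = e^{-U²}/8 ≤ 1/100`, `a_1 ∈ [1/(2Lg), 9/(8Lg)]`, `I ≥ 0`, `I_0 = 1`, `I_1 ≥ 1/2`,
  and the parity balance `|Σ_n (-1)^n I_{n-1}(U)| ≤ 1/(U-1)` (`ModelCellFacts.abs_alternating_sum_le`).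
-/

noncomputable section

namespace Summit.Parity.GeneralizedHardyLittlewood.Cruxes.AbsoluteUpgrade.DipMarginRateExchange

open scoped BigOperators
open Finset
open Summit.Parity.GeneralizedHardyLittlewood.Cruxes.ModelHyperbolicity.WindowChainTransport (cellDensity
  cellDensity_zero calc_nonneg calc_cellDensity_succ_eq_zero)
open Summit.Parity.GeneralizedHardyLittlewood.Theorems.ModelCellFacts (abs_alternating_sum_le)

/-! ## Margin parameters against the saving -/

/-- `U^p ≤ exp(U²)` for natural `p ≤ U` (from `U ≤ e^U`). -/
theorem quantClip_pow_le_exp_sq {p U : ℕ} (hp : p ≤ U) : (U : ℝ) ^ p ≤ Real.exp ((U : ℝ) ^ 2) := by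
  have hU0 : (0 : ℝ) ≤ U := Nat.cast_nonneg U
  have h1 : (U : ℝ) ≤ Real.exp U := by linarith [Real.add_one_le_exp (U : ℝ)]
  have hp' : (p : ℝ) ≤ U := by exact_mod_cast hp
  calc (U : ℝ) ^ p ≤ (Real.exp U) ^ p := pow_le_pow_left₀ hU0 h1 p
    _ = Real.exp (p * U) := by rw [← Real.exp_nat_mul]
    _ ≤ Real.exp ((U : ℝ) ^ 2) := Real.exp_le_exp.2 (by rw [sq]; exact mul_le_mul_of_nonneg_right hp' hU0)

/-- **The margin parameters against the saving.**  If `2^{t+1} U^{U+3t-1}/η₀ ≤ Lg^δ` (the saving beats the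
floor) and `2t + 4 ≤ U`, then `ν₀ = 2^{t-1} U^{t-1}/(η₀ Lg^δ)` satisfies `4 ν₀ ≤ U^{-2t}`, `ν₀ ≤ U^{-2t} U^{-U}`,
and the anatomy's accuracy satisfies `3 e^{-U²}/8 ≤ U^{-2t-4}`. -/
theorem quantClip_numericsB {t U : ℕ} (ht : 1 ≤ t) (hU2t : 2 * t + 4 ≤ U) {η₀ Lg δ : ℝ} (hη₀ : 0 < η₀)
    (hLgδ : 0 < Lg ^ δ) (hκδ : 2 ^ (t + 1) / η₀ * (U : ℝ) ^ (U + (3 * t - 1)) ≤ Lg ^ δ) :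
    4 * (2 ^ (t - 1) * (U : ℝ) ^ (t - 1) / (η₀ * Lg ^ δ)) ≤ ((U : ℝ) ^ (2 * t))⁻¹ ∧
      2 ^ (t - 1) * (U : ℝ) ^ (t - 1) / (η₀ * Lg ^ δ) ≤ ((U : ℝ) ^ (2 * t))⁻¹ * ((U : ℝ) ^ U)⁻¹ ∧
      3 * (Real.exp (-((U : ℝ) ^ 2)) / 8) ≤ ((U : ℝ) ^ (2 * t + 4))⁻¹ := by
  have hU1 : (1 : ℝ) ≤ U := by exact_mod_cast (show 1 ≤ U by omega)
  have hUpos : (0 : ℝ) < U := by linarith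
  have hpow : (U : ℝ) ^ (t - 1) * ((U : ℝ) ^ (2 * t) * (U : ℝ) ^ U) = (U : ℝ) ^ (U + (3 * t - 1)) := by
    rw [← pow_add, ← pow_add]; congr 1; omega
  have h22 : (4 : ℝ) * 2 ^ (t - 1) = 2 ^ (t + 1) := by
    rw [show t + 1 = (t - 1) + 2 by omega, pow_add]; norm_num; ring
  have hmain : 2 ^ (t + 1) * (U : ℝ) ^ (U + (3 * t - 1)) ≤ η₀ * Lg ^ δ := by
    have := hκδ
    rw [div_mul_eq_mul_div, div_le_iff₀ hη₀] at this
    linarith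
  have hνϑf : 4 * (2 ^ (t - 1) * (U : ℝ) ^ (t - 1) / (η₀ * Lg ^ δ)) ≤
      ((U : ℝ) ^ (2 * t))⁻¹ * ((U : ℝ) ^ U)⁻¹ := by
    have hgoal : 4 * (2 ^ (t - 1) * (U : ℝ) ^ (t - 1)) / (η₀ * Lg ^ δ) ≤
        1 / ((U : ℝ) ^ (2 * t) * (U : ℝ) ^ U) := by
      rw [div_le_div_iff₀ (mul_pos hη₀ hLgδ) (by positivity), one_mul]
      calc 4 * (2 ^ (t - 1) * (U : ℝ) ^ (t - 1)) * ((U : ℝ) ^ (2 * t) * (U : ℝ) ^ U)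
          = (4 * 2 ^ (t - 1)) * ((U : ℝ) ^ (t - 1) * ((U : ℝ) ^ (2 * t) * (U : ℝ) ^ U)) := by ring
        _ = 2 ^ (t + 1) * (U : ℝ) ^ (U + (3 * t - 1)) := by rw [hpow, h22]
        _ ≤ η₀ * Lg ^ δ := hmain
    calc 4 * (2 ^ (t - 1) * (U : ℝ) ^ (t - 1) / (η₀ * Lg ^ δ))
        = 4 * (2 ^ (t - 1) * (U : ℝ) ^ (t - 1)) / (η₀ * Lg ^ δ) := by ring
      _ ≤ 1 / ((U : ℝ) ^ (2 * t) * (U : ℝ) ^ U) := hgoal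
      _ = ((U : ℝ) ^ (2 * t))⁻¹ * ((U : ℝ) ^ U)⁻¹ := by rw [one_div, mul_inv]
  have hf1 : ((U : ℝ) ^ U)⁻¹ ≤ 1 := inv_le_one_of_one_le₀ (one_le_pow₀ hU1)
  have hϑ0 : 0 ≤ ((U : ℝ) ^ (2 * t))⁻¹ := by positivity
  have hν0 : 0 ≤ 2 ^ (t - 1) * (U : ℝ) ^ (t - 1) / (η₀ * Lg ^ δ) :=
    div_nonneg (by positivity) (mul_pos hη₀ hLgδ).le
  refine ⟨le_trans hνϑf (mul_le_of_le_one_right hϑ0 hf1), le_trans (by linarith) hνϑf, ?_⟩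
  have h1 : (U : ℝ) ^ (2 * t + 4) ≤ Real.exp ((U : ℝ) ^ 2) := quantClip_pow_le_exp_sq hU2t
  have h2 : Real.exp (-((U : ℝ) ^ 2)) ≤ ((U : ℝ) ^ (2 * t + 4))⁻¹ := by
    rw [Real.exp_neg]; exact inv_anti₀ (by positivity) h1
  linarith [Real.exp_pos (-((U : ℝ) ^ 2))]

/-- **The smallness transfer along the schedule**: with `E₀ = N/(Lg^t Lg^δ)`, `ν₀ = 2^{t-1} U^{t-1}/(η₀ Lg^δ)`,
`η₀ N ≤ MS` and `1/(2 Lg) ≤ a_1`: `E₀ U^{t-1} Lg ≤ ν₀ · MS · a_1^{t-1}` (in fact `E₀ U^{t-1} Lg = ν₀ (η₀N)(1/(2Lg))^{t-1}`). -/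
theorem quantClip_smallness {t : ℕ} (ht : 1 ≤ t) {U N Lg δ η₀ MS a1 : ℝ} (hU : 0 ≤ U) (hN : 0 < N)
    (hLg : 0 < Lg) (hη₀ : 0 < η₀) (hMS : η₀ * N ≤ MS) (ha1 : 1 / 2 / Lg ≤ a1) :
    N / (Lg ^ t * Lg ^ δ) * U ^ (t - 1) * Lg ≤
      2 ^ (t - 1) * U ^ (t - 1) / (η₀ * Lg ^ δ) * MS * a1 ^ (t - 1) := by
  have hlogt' : Lg ^ t = Lg ^ (t - 1) * Lg := by
    conv_lhs => rw [← Nat.sub_add_cancel ht, pow_succ]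
  have hMSpos : 0 ≤ MS := le_trans (by positivity) hMS
  have h1 : N / (Lg ^ t * Lg ^ δ) * U ^ (t - 1) * Lg =
      2 ^ (t - 1) * U ^ (t - 1) / (η₀ * Lg ^ δ) * ((η₀ * N) * (1 / 2 / Lg) ^ (t - 1)) := by
    rw [hlogt', div_pow, div_pow, one_pow]
    field_simp
  rw [h1, mul_assoc (2 ^ (t - 1) * U ^ (t - 1) / (η₀ * Lg ^ δ))]
  refine mul_le_mul_of_nonneg_left ?_ (by positivity)
  exact mul_le_mul hMS (pow_le_pow_left₀ (by positivity) ha1 _) (by positivity) hMSpos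

/-- **The law's own error is absolute**: `E₀ = N/(Lg^t Lg^δ) ≤ (ε/2) N/Lg^t` as soon as
`2^{t+1} U^{U+3t-1}/η₀ ≤ Lg^δ` with `η₀ ≤ ε` and `U ≥ 1` (then `Lg^δ ≥ 2/ε`). -/
theorem quantClip_errorA {t U : ℕ} (hU1 : 1 ≤ U) {ε η₀ N Lg δ : ℝ} (hε : 0 < ε) (hη₀ : 0 < η₀) (hη₀ε : η₀ ≤ ε)
    (hN : 0 ≤ N) (hLg : 0 < Lg) (hLgδ : 0 < Lg ^ δ)
    (hκδ : 2 ^ (t + 1) / η₀ * (U : ℝ) ^ (U + (3 * t - 1)) ≤ Lg ^ δ) :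
    N / (Lg ^ t * Lg ^ δ) ≤ ε / 2 * (N / Lg ^ t) := by
  have hU1' : (1 : ℝ) ≤ U := by exact_mod_cast hU1
  have hκδε : 2 / ε ≤ Lg ^ δ := by
    refine le_trans ?_ hκδ
    have hUp : (1 : ℝ) ≤ (U : ℝ) ^ (U + (3 * t - 1)) := one_le_pow₀ hU1'
    have h2t : (2 : ℝ) ≤ 2 ^ (t + 1) := by
      have : (1 : ℝ) ≤ 2 ^ t := one_le_pow₀ (by norm_num)
      rw [pow_succ]; linarith
    calc 2 / ε ≤ 2 / η₀ := div_le_div_of_nonneg_left (by norm_num) hη₀ hη₀ε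
      _ ≤ 2 ^ (t + 1) / η₀ := div_le_div_of_nonneg_right h2t hη₀.le
      _ = 2 ^ (t + 1) / η₀ * 1 := (mul_one _).symm
      _ ≤ 2 ^ (t + 1) / η₀ * (U : ℝ) ^ (U + (3 * t - 1)) := mul_le_mul_of_nonneg_left hUp (by positivity)
  have hid : N / (Lg ^ t * Lg ^ δ) = (N / Lg ^ t) * (1 / Lg ^ δ) := by field_simp
  rw [hid, mul_comm]
  refine mul_le_mul_of_nonneg_right ?_ (by positivity)
  rw [div_le_iff₀ hLgδ]
  have h := mul_le_mul_of_nonneg_left hκδε (by positivity : (0 : ℝ) ≤ ε / 2)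
  rwa [show ε / 2 * (2 / ε) = 1 by field_simp] at h

/-! ## The two cases of the key estimate -/

/-- **Case A (small singular mass).**  `MS < η₀ N` with `η₀ = ε/(4·4^t)`, `0 ≤ X ≤ MS (9/(8 Lg))^t` and
`|Θ − 1| ≤ 2^{t+1}` give `|Θ − 1| X ≤ (ε/2) N/Lg^t` (as `(9/4)^t ≤ 4^t`). -/
theorem quantClip_caseA {t : ℕ} {ε N Lg MS X Θ : ℝ} (hε : 0 < ε) (hN : 0 < N) (hLg : 0 < Lg)
    (hMS : MS < ε / (4 * 4 ^ t) * N) (hX0 : 0 ≤ X) (hX : X ≤ MS * (9 / 8 / Lg) ^ t)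
    (hΘ : |Θ - 1| ≤ 2 ^ t * 2) : |Θ - 1| * X ≤ ε / 2 * (N / Lg ^ t) := by
  have h1 : |Θ - 1| * X ≤ 2 ^ t * 2 * (ε / (4 * 4 ^ t) * N * (9 / 8 / Lg) ^ t) :=
    mul_le_mul hΘ (hX.trans (mul_le_mul_of_nonneg_right hMS.le (by positivity))) hX0 (by positivity)
  refine h1.trans ?_
  have hid : (2 : ℝ) ^ t * 2 * (ε / (4 * 4 ^ t) * N * (9 / 8 / Lg) ^ t) =
      (ε / 2 * (N / Lg ^ t)) * ((2 * (9 / 8)) ^ t / 4 ^ t) := by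
    rw [mul_pow, div_pow, div_pow]
    field_simp
    norm_num
  rw [hid]
  refine mul_le_of_le_one_right (by positivity) ?_
  rw [div_le_one (by positivity)]
  exact pow_le_pow_left₀ (by norm_num) (by norm_num) t

/-- **Case B (the amplitudes are clipped).**  `|Θ − 1| ≤ 2^t 8^{t-1} (2^t + 1) U^{-2t}`,
`0 ≤ X ≤ MS (9/(8 Lg))^t`, `MS ≤ C N (log log N)^{t-1}` with `0 ≤ log log N ≤ (2U+2)²`, and
`U ≥ 2 K₃/ε` for `K₃ = 2^t 8^{t-1} (2^t+1) 4^{2t-2} (9/8)^t C` give `|Θ − 1| X ≤ (ε/2) N/Lg^t`. -/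
theorem quantClip_caseB {t U : ℕ} (ht : 1 ≤ t) (hU1 : 1 ≤ U) {ε N Lg MS X Θ C ll : ℝ} (hε : 0 < ε)
    (hN : 0 < N) (hLg : 0 < Lg) (hC : 0 < C) (hMSle : MS ≤ C * N * ll ^ (t - 1))
    (hll0 : 0 ≤ ll) (hll : ll ≤ (2 * (U : ℝ) + 2) ^ 2) (hX0 : 0 ≤ X) (hX : X ≤ MS * (9 / 8 / Lg) ^ t)
    (hΘ : |Θ - 1| ≤ 2 ^ t * 8 ^ (t - 1) * (2 ^ t + 1) * ((U : ℝ) ^ (2 * t))⁻¹)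
    (hUK : 2 * (2 ^ t * 8 ^ (t - 1) * (2 ^ t + 1) * (4 : ℝ) ^ (2 * (t - 1)) * (9 / 8) ^ t * C) / ε ≤ U) :
    |Θ - 1| * X ≤ ε / 2 * (N / Lg ^ t) := by
  have hU1' : (1 : ℝ) ≤ U := by exact_mod_cast hU1
  have hUpos : (0 : ℝ) < U := by linarith
  set K₃ : ℝ := 2 ^ t * 8 ^ (t - 1) * (2 ^ t + 1) * (4 : ℝ) ^ (2 * (t - 1)) * (9 / 8) ^ t * C with hK₃
  have hK₃pos : 0 < K₃ := by positivity
  have hll' : ll ^ (t - 1) ≤ ((4 : ℝ) * U) ^ (2 * (t - 1)) := by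
    have h1 : ll ≤ ((4 : ℝ) * U) ^ 2 := le_trans hll (by nlinarith)
    calc ll ^ (t - 1) ≤ (((4 : ℝ) * U) ^ 2) ^ (t - 1) := pow_le_pow_left₀ hll0 h1 _
      _ = ((4 : ℝ) * U) ^ (2 * (t - 1)) := by rw [← pow_mul]
  have hXB : X ≤ C * N * ((4 : ℝ) * U) ^ (2 * (t - 1)) * (9 / 8 / Lg) ^ t := by
    calc X ≤ MS * (9 / 8 / Lg) ^ t := hX
      _ ≤ (C * N * ll ^ (t - 1)) * (9 / 8 / Lg) ^ t := mul_le_mul_of_nonneg_right hMSle (by positivity)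
      _ ≤ (C * N * ((4 : ℝ) * U) ^ (2 * (t - 1))) * (9 / 8 / Lg) ^ t := by gcongr
  have hU2t' : (U : ℝ) ^ (2 * t) = (U : ℝ) ^ (2 * (t - 1)) * (U : ℝ) ^ 2 := by
    rw [← pow_add]; congr 1; omega
  have hcomb : |Θ - 1| * X ≤ K₃ / (U : ℝ) ^ 2 * (N / Lg ^ t) := by
    calc |Θ - 1| * X ≤ (2 ^ t * 8 ^ (t - 1) * (2 ^ t + 1) * ((U : ℝ) ^ (2 * t))⁻¹) *
          (C * N * ((4 : ℝ) * U) ^ (2 * (t - 1)) * (9 / 8 / Lg) ^ t) :=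
          mul_le_mul hΘ hXB hX0 (by positivity)
      _ = K₃ / (U : ℝ) ^ 2 * (N / Lg ^ t) := by
          rw [hK₃, mul_pow, div_pow, hU2t']
          field_simp
  have hfin : K₃ / (U : ℝ) ^ 2 ≤ ε / 2 := by
    rw [div_le_iff₀ (by positivity)]
    have h1 : K₃ ≤ ε / 2 * U := by rw [div_le_iff₀ hε] at hUK; linarith
    have h2 : ε / 2 * U ≤ ε / 2 * (U : ℝ) ^ 2 := by
      refine mul_le_mul_of_nonneg_left ?_ (by positivity)
      nlinarith
    linarith
  exact hcomb.trans (mul_le_mul_of_nonneg_right hfin (by positivity))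

/-! ## The anatomy along the schedule, repackaged -/

/-- **Scale facts.**  At a scale with roughness `U ≥ 16`, `N > 0`, `Lg > 0`, model cells `A n` with `A U = 0` and
the anatomy `|A_m Lg/N − I_{m}(U)| ≤ (e^{-U²}/8) I_m(U)` for `1 ≤ m < U` (`I_m(U) = cellDensity (m-1) U`): the
densities `a_n = A_n/N` obey the anatomy for ALL `1 ≤ n ≤ U`, `e^{-U²}/8 ≤ 1/100`, `a_1 ∈ [1/(2Lg), 9/(8Lg)]`,
`a_1 > 0`; the abstract densities are `≥ 0` with `I_1 = 1`, `I_2 ≥ 1/2`, and balanced: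
`|Σ_{n=1}^U (-1)^n cellDensity (n-1) U| ≤ 1/(U-1)`. -/
theorem quantClip_scaleFacts : ∀ {U : ℕ}, 16 ≤ U → ∀ {N Lg : ℝ}, 0 < N → 0 < Lg → ∀ A : ℕ → ℕ, A U = 0 → (∀ m : ℕ, 1 ≤ m → m < U → |(A m : ℝ) * Lg / N - cellDensity (m - 1) U| ≤ Real.exp (-((U : ℝ) ^ 2)) / 8 * cellDensity (m - 1) U) → (∀ n ∈ Finset.Icc 1 U, |(A n : ℝ) / N * Lg - cellDensity (n - 1) U| ≤ Real.exp (-((U : ℝ) ^ 2)) / 8 * cellDensity (n - 1) U) ∧ Real.exp (-((U : ℝ) ^ 2)) / 8 ≤ 1 / 100 ∧ 0 < (A 1 : ℝ) / N ∧ (A 1 : ℝ) / N ≤ 9 / 8 / Lg ∧ 1 / 2 / Lg ≤ (A 1 : ℝ) / N ∧ (∀ j : ℕ, 0 ≤ cellDensity j U) ∧ 1 ≤ cellDensity 0 U ∧ 1 / 2 ≤ cellDensity 1 U ∧ |∑ n ∈ Finset.Icc 1 U, (-1 : ℝ) ^ n * cellDensity (n - 1) U| ≤ 1 / ((U : ℝ)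 - 1) := by
  intro U hU16 N Lg hN hLg A hAtop hAN
  have hU1 : 1 ≤ U := by omega
  have hU2 : 2 ≤ U := by omega
  have hUreal : (16 : ℝ) ≤ U := by exact_mod_cast hU16
  -- accuracy
  have hεa100 : Real.exp (-((U : ℝ) ^ 2)) / 8 ≤ 1 / 100 := by
    have h1 : (U : ℝ) ^ 2 + 1 ≤ Real.exp ((U : ℝ) ^ 2) := Real.add_one_le_exp _
    have hsq : (16 : ℝ) ^ 2 ≤ (U : ℝ) ^ 2 := pow_le_pow_left₀ (by norm_num) hUreal 2
    have h3 : (257 : ℝ) ≤ Real.exp ((U : ℝ) ^ 2) := by linarith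
    have h4 : (Real.exp ((U : ℝ) ^ 2))⁻¹ ≤ 1 / 257 := by
      rw [inv_eq_one_div]; exact one_div_le_one_div_of_le (by norm_num) h3
    rw [Real.exp_neg]
    linarith
  -- abstract densities
  have hI : ∀ j, 0 ≤ cellDensity j U := fun j => calc_nonneg j _
  have hI0 : (1 : ℝ) ≤ cellDensity 0 U := by rw [cellDensity_zero]
  have hI1 : 1 / 2 ≤ cellDensity 1 U := by
    have h := anatomyAlong_densityLower 1 (U : ℝ) (by push_cast; linarith)
    refine le_trans ?_ h
    rw [Nat.factorial_one, Nat.cast_one, pow_one, pow_one, one_mul, le_div_iff₀ (by linarith)]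
    linarith
  have htop : cellDensity (U - 1) U = 0 := by
    rw [show U - 1 = (U - 2) + 1 by omega]
    refine calc_cellDensity_succ_eq_zero (U - 2) U ?_
    rw [Nat.cast_sub hU2]
    push_cast
    linarith
  -- anatomy for all `1 ≤ n ≤ U`
  have hanat : ∀ n ∈ Finset.Icc 1 U, |(A n : ℝ) / N * Lg - cellDensity (n - 1) U| ≤
      Real.exp (-((U : ℝ) ^ 2)) / 8 * cellDensity (n - 1) U := by
    intro n hn
    rw [Finset.mem_Icc] at hn
    rcases hn.2.lt_or_eq with hlt | heq
    · have h := hAN n hn.1 hlt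
      rwa [show (A n : ℝ) / N * Lg = (A n : ℝ) * Lg / N by ring]
    · rw [heq, htop, hAtop, Nat.cast_zero, zero_div, zero_mul, sub_zero, abs_zero, mul_zero]
  -- the first density
  have ha1κ : |(A 1 : ℝ) / N * Lg - 1| ≤ Real.exp (-((U : ℝ) ^ 2)) / 8 := by
    have h := hanat 1 (Finset.mem_Icc.2 ⟨le_rfl, hU1⟩)
    rwa [Nat.sub_self, cellDensity_zero, mul_one] at h
  have ha1pos : 0 < (A 1 : ℝ) / N := by
    have h := (abs_le.1 ha1κ).1
    exact lt_of_mul_lt_mul_right (by rw [zero_mul]; linarith) hLg.le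
  have ha1le : (A 1 : ℝ) / N ≤ 9 / 8 / Lg := by
    rw [le_div_iff₀ hLg]; have := (abs_le.1 ha1κ).2; linarith
  have ha1ge : 1 / 2 / Lg ≤ (A 1 : ℝ) / N := by
    rw [div_le_iff₀ hLg]; have := (abs_le.1 ha1κ).1; linarith
  exact ⟨hanat, hεa100, ha1pos, ha1le, ha1ge, hI, hI0, hI1, abs_alternating_sum_le hU2⟩

end Summit.Parity.GeneralizedHardyLittlewood.Cruxes.AbsoluteUpgrade.DipMarginRateExchange

end
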